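import Mathlib
import Literature.NumberTheory.LFunctions.PeriodicDirichletSeriesSmoothPart
import HarnessLib

/-!
# The `M(q)`-decomposition of a periodic Dirichlet series (Chatterjee–Murty 2014, §4), II: `s → 1⁺`

Topic `Literature/NumberTheory/LFunctions`; namespace `Literature.NumberTheory.LFunctions.ChatterjeeMurty2014`.
THEOREMS only (no definition, no named fact, no `sorry`); cell pub-zeta5, P1 g58. Sequel of
`PeriodicDirichletSeriesSmoothPart.lean`: the analytic half of OKADA'S CRITERION [Okada1982] in the
Dirichlet-series form of T. Chatterjee, M. Ram Murty, *Non-vanishing of Dirichlet series with periodic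
coefficients*, J. Number Theory **145** (2014) 1–21 [ChatterjeeMurty2014], §4, proof of Theorem 3 (READ on
arXiv:1405.6982).

## Source (read on the page), §4

«Thus, we have `L(s,f) = Σ_{b∈M(q)} b^{−s} Σ_{χ mod q} (f_b,χ) L(s,χ)` … `(5)`. Now, consider the sum
`Σ_{(c,q)=1} L(s,f_c)` … so that, we have `Σ_{(c,q)=1} L(s,f_c) = φ(q)[(φ(q)/q · Σ_{b∈M(q)} (f_b,χ₀)/b)·1/(s−1) +
Σ_{b∈M(q)} (f_b,χ₀)/b · (−Σ_{d∣q} μ(d) log d/d + γφ(q)/q − (φ(q)/q) log b) + O(s−1)]`. Note that the left hand side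
does not have a pole at `s = 1` and hence from the above equation, we get `Σ_{b∈M(q)} (f_b,χ₀)/b = 0` `(6)`. …
Thus using (6), the above identity becomes `Σ_{b∈M(q)} (f_b,χ₀) log b / b = 0` `(8)`.»

## Route and what is proved (`N ≥ 1`, `M(N)` = `Nat.factoredNumbers N.primeFactors`, `χ₀ = (1 : DirichletCharacter ℂ N)`)

The kernel route replaces the character expansion `Σ_χ (f_b,χ)L(s,χ)` of display (5) by the constant term of the
WHOLE periodic `L`-function `L(s, χ₀ f(m·))` at `s = 1` (P1 g56's `HurwitzZetaOne.tendsto_LFunction_sub_div`: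
`L(s,Φ) − (Σ_jΦ(j))/N/(s−1) → −N⁻¹Σ_{a=1}^{N} Φ(a)(ψ(a/N) + log N)`), which carries the same information
(disclosed deviation of equal content): for real `σ → 1⁺`, the decomposition of part I splits `L(σ,f)` into a
regular part (dominated convergence, Mathlib `tendsto_tsum_of_dominated_convergence`, with a bound uniform over the
finitely many functions `χ₀f(c·)`, `c ∈ ℤ/N` — `exists_eventually_norm_sub_le`) and the pole-carrying smooth
series `h(σ) = N⁻¹Σ_{m∈M(N)} S(m) m^{−σ}`, `S(m) = Σ_{j unit} f(mj)`, divided by `σ − 1`; since `L(σ,f) → L(1,f)`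
(`Σ_j f(j) = 0`), `h(1) = 0` and `h(σ)/(σ−1) → h′(1)` (part I's `hasDerivAt_LSeries_indicator_factoredNumbers`):

* `LFunction_one_eq_tsum_aux` — the core limit statement;
* **`tsum_sum_units_div_eq_zero`** — display (6): `Σ_{m∈M(N)} (1/m) Σ_{j unit} f(mj) = 0`;
* **`LFunction_one_eq_tsum`** — `N·L(1,f) = −Σ_{m∈M(N)} (1/m) Σ_{a=1}^{N} χ₀(a) f(ma)(ψ(a/N) + log N)
  − Σ_{m∈M(N)} (log m/m) Σ_{j unit} f(mj)`;
* **`LFunction_one_eq_sum_digamma_mul_tsum`** — the form Okada's criterion uses: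
  `N·L(1,f) = −Σ_{a=1}^{N} χ₀(a)ψ(a/N)·G(a) − Σ_{m∈M(N)} (log m/m) Σ_{j unit} f(mj)` with
  `G(a) = Σ_{m∈M(N)} f(ma)/m` (Chatterjee–Murty's `Σ_{b∈M(q)} f(ab)/b`) and the last sum
  `= φ(q)·Σ_{b∈M(q)} ((f_b,χ₀)/b) log b`;
* `summable_factoredNumbers_div` — `Σ_{m∈M(N)} c(m)/m` converges absolutely for bounded `c`.

The transcendence half (Baker's theorem ⇒ Okada's criterion ⇒ Erdős's conjecture for `2φ(q)+1 > q`) is in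
`Literature/NumberTheory/Transcendental/OkadaVanishingCriterionProofs.lean`. HONEST FRAMING: analytic bookkeeping
of a printed 2014 proof; nothing here concerns `ζ(5)`.
-/

noncomputable section

open Complex Finset Filter Topology

namespace Literature.NumberTheory.LFunctions

namespace ChatterjeeMurty2014

variable {N : ℕ} [NeZero N]

/-- The real approach `σ → 1⁺` maps into the punctured complex neighbourhood of `1`. [folklore] -/
private theorem tendsto_ofReal_nhdsGT :
    Tendsto (fun σ : ℝ => (σ : ℂ)) (𝓝[>] (1 : ℝ)) (𝓝[≠] (1 : ℂ)) := by
  have h := Complex.continuous_ofReal.continuousWithinAt.tendsto_nhdsWithin (s := Set.Ioi (1 : ℝ))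
    (t := ({1}ᶜ : Set ℂ)) (x := 1) fun σ hσ => ?_
  · simpa only [Complex.ofReal_one] using h
  · simp only [Set.mem_compl_iff, Set.mem_singleton_iff, Complex.ofReal_eq_one]
    exact ne_of_gt hσ

/-- The real approach `σ → 1⁺`, seen in `ℂ`, tends to `1`. [folklore] -/
private theorem tendsto_ofReal_nhdsGT_nhds : Tendsto (fun σ : ℝ => (σ : ℂ)) (𝓝[>] (1 : ℝ)) (𝓝 (1 : ℂ)) :=
  (tendsto_ofReal_nhdsGT).mono_right nhdsWithin_le_nhds

/-- A function on the finite set `ℤ/N` is bounded by the sum of its norms. [folklore] -/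
private theorem norm_le_sum_norm (g : ZMod N → ℂ) (c : ZMod N) : ‖g c‖ ≤ ∑ c' : ZMod N, ‖g c'‖ :=
  Finset.single_le_sum (f := fun c' => ‖g c'‖) (fun _ _ => norm_nonneg _) (Finset.mem_univ c)

/-- **Uniform bound near `s = 1`.** For `f : ℤ/N → ℂ` and the finitely many functions `Ψ_c = χ₀·f(c·)`, `c ∈ ℤ/N`,
the regular parts `L(σ, Ψ_c) − (Σ_j Ψ_c(j))/N/(σ−1)` are bounded uniformly in `c` for real `σ → 1⁺` (each has a
limit, P1 g56's `HurwitzZetaOne.tendsto_LFunction_sub_div`). [cite: ChatterjeeMurty2014, §4 (proof of Theorem 3)] -/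
theorem exists_eventually_norm_sub_le (f : ZMod N → ℂ) :
    ∃ C : ℝ, ∀ᶠ σ : ℝ in 𝓝[>] 1, ∀ c : ZMod N,
      ‖ZMod.LFunction (fun j => (1 : DirichletCharacter ℂ N) j * f (c * j)) σ -
        (∑ j : ZMod N, (1 : DirichletCharacter ℂ N) j * f (c * j)) / N / ((σ : ℂ) - 1)‖ ≤ C := by
  set ℓ : ZMod N → ℂ := fun c => -(N : ℂ)⁻¹ * ∑ a ∈ Icc 1 N,
    (1 : DirichletCharacter ℂ N) (a : ZMod N) * f (c * (a : ZMod N)) *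
      (Complex.digamma ((a : ℂ) / N) + Real.log N) with hℓ
  refine ⟨∑ c : ZMod N, (‖ℓ c‖ + 1), ?_⟩
  have h : ∀ c : ZMod N, ∀ᶠ σ : ℝ in 𝓝[>] 1,
      ‖ZMod.LFunction (fun j => (1 : DirichletCharacter ℂ N) j * f (c * j)) σ -
        (∑ j : ZMod N, (1 : DirichletCharacter ℂ N) j * f (c * j)) / N / ((σ : ℂ) - 1)‖ < ‖ℓ c‖ + 1 := by
    intro c
    have ht := ((HurwitzZetaOne.tendsto_LFunction_sub_div
      (fun j => (1 : DirichletCharacter ℂ N) j * f (c * j))).comp tendsto_ofReal_nhdsGT).norm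
    exact (tendsto_order.1 ht).2 _ (lt_add_one _)
  filter_upwards [Filter.eventually_all.mpr h] with σ hσ c
  exact (hσ c).le.trans (Finset.single_le_sum (f := fun c' => ‖ℓ c'‖ + 1)
    (fun _ _ => by positivity) (Finset.mem_univ c))


/-- **The passage `s → 1⁺` (core).** For `f : ℤ/N → ℂ` with `Σ_j f(j) = 0`, writing `S(m) = Σ_j χ₀(j) f(mj)`:
(i) `Σ_{m∈M(N)} S(m) m^{−1}/N = 0` (no pole), and (ii)
`L(1,f) = Σ_{m∈M(N)} m^{−1}·ℓ_m − Σ_{m∈M(N)} m^{−1} (log m) S(m)/N`, where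
`ℓ_m = −N⁻¹ Σ_{a=1}^{N} χ₀(a) f(ma) (ψ(a/N) + log N)` is the constant term of `L(s, χ₀ f(m·))` at `s = 1`
(decomposition for `σ > 1`, dominated convergence, and the derivative of the pole-carrying smooth series).
[cite: ChatterjeeMurty2014, §4 (proof of Theorem 3, displays (5)–(7))] -/
theorem LFunction_one_eq_tsum_aux (f : ZMod N → ℂ) (hf : ∑ j : ZMod N, f j = 0) :
    (∑' m : Nat.factoredNumbers N.primeFactors, ((m : ℕ) : ℂ) ^ (-(1 : ℂ)) *
        ((∑ j : ZMod N, (1 : DirichletCharacter ℂ N) j * f ((m : ℕ) * j)) / N)) = 0 ∧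
    ZMod.LFunction f 1 =
      (∑' m : Nat.factoredNumbers N.primeFactors, ((m : ℕ) : ℂ) ^ (-(1 : ℂ)) *
        (-(N : ℂ)⁻¹ * ∑ a ∈ Icc 1 N, (1 : DirichletCharacter ℂ N) (a : ZMod N) * f ((m : ℕ) * (a : ZMod N)) *
          (Complex.digamma ((a : ℂ) / N) + Real.log N))) +
      -(∑' m : Nat.factoredNumbers N.primeFactors, ((m : ℕ) : ℂ) ^ (-(1 : ℂ)) *
        (Complex.log ((m : ℕ) : ℂ) * ((∑ j : ZMod N, (1 : DirichletCharacter ℂ N) j * f ((m : ℕ) * j)) / N))) := by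
  -- notation (local abbreviations inside the proof)
  set χ₀ : DirichletCharacter ℂ N := 1 with hχ₀
  set Ψ : ZMod N → ZMod N → ℂ := fun c j => χ₀ j * f (c * j) with hΨ
  set S : ZMod N → ℂ := fun c => ∑ j : ZMod N, Ψ c j with hS
  set R : ZMod N → ℂ → ℂ := fun c s => ZMod.LFunction (Ψ c) s - S c / N / (s - 1) with hR
  set ℓ : ZMod N → ℂ := fun c => -(N : ℂ)⁻¹ * ∑ a ∈ Icc 1 N, Ψ c (a : ZMod N) *
    (Complex.digamma ((a : ℂ) / N) + Real.log N) with hℓ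
  set a : ℕ → ℂ := (Nat.factoredNumbers N.primeFactors).indicator (fun n : ℕ => S (n : ZMod N) / N) with ha
  have hN : (N : ℂ) ≠ 0 := by exact_mod_cast NeZero.ne N
  -- (F1) the constant terms
  have hF1 : ∀ c : ZMod N, Tendsto (fun σ : ℝ => R c σ) (𝓝[>] 1) (𝓝 (ℓ c)) := fun c =>
    (HurwitzZetaOne.tendsto_LFunction_sub_div (Ψ c)).comp tendsto_ofReal_nhdsGT
  -- (F2) uniform bound
  obtain ⟨C, hC⟩ := exists_eventually_norm_sub_le f
  -- bounded coefficients
  have hSb : ∀ n : ℕ, ‖S (n : ZMod N) / N‖ ≤ ∑ c : ZMod N, ‖S c / N‖ := fun n =>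
    norm_le_sum_norm (fun c => S c / N) n
  -- (F3)+(F5) the decomposition for `σ > 1`
  have hdec : ∀ σ : ℝ, 1 < σ → ZMod.LFunction f σ =
      (∑' m : Nat.factoredNumbers N.primeFactors, ((m : ℕ) : ℂ) ^ (-(σ : ℂ)) * R (m : ℕ) σ) +
        ((σ : ℂ) - 1)⁻¹ * LSeries a σ := by
    intro σ hσ
    have hs : 1 < ((σ : ℂ)).re := by simpa using hσ
    have hs0 : 0 < ((σ : ℂ)).re := by linarith
    rw [ZMod.LFunction_eq_LSeries f hs, LSeries_eq_tsum_factoredNumbers f hs,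
      LSeries_indicator_factoredNumbers_eq_tsum, ← tsum_mul_left]
    have h1 : Summable fun m : Nat.factoredNumbers N.primeFactors =>
        ((m : ℕ) : ℂ) ^ (-(σ : ℂ)) * R (m : ℕ) σ :=
      summable_factoredNumbers_cpow_mul (c := fun n : ℕ => R (n : ZMod N) σ)
        (fun n => norm_le_sum_norm (fun c => R c σ) n) hs0
    have h2 : Summable fun m : Nat.factoredNumbers N.primeFactors =>
        ((σ : ℂ) - 1)⁻¹ * (((m : ℕ) : ℂ) ^ (-(σ : ℂ)) * (S (m : ℕ) / N)) :=
      (summable_factoredNumbers_cpow_mul (c := fun n : ℕ => S (n : ZMod N) / N) hSb hs0).mul_left _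
    rw [← h1.tsum_add h2]
    refine tsum_congr fun m => ?_
    simp only [hR]
    ring
  -- (F6) `L(σ, f) → L(1, f)`
  have hF6 : Tendsto (fun σ : ℝ => ZMod.LFunction f σ) (𝓝[>] 1) (𝓝 (ZMod.LFunction f 1)) :=
    (ZMod.differentiableAt_LFunction f 1 (Or.inr hf)).continuousAt.tendsto.comp tendsto_ofReal_nhdsGT_nhds
  -- (F7) dominated convergence for the regular part
  have hF7 : Tendsto (fun σ : ℝ => ∑' m : Nat.factoredNumbers N.primeFactors,
      ((m : ℕ) : ℂ) ^ (-(σ : ℂ)) * R (m : ℕ) σ) (𝓝[>] 1)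
      (𝓝 (∑' m : Nat.factoredNumbers N.primeFactors, ((m : ℕ) : ℂ) ^ (-(1 : ℂ)) * ℓ (m : ℕ))) := by
    refine tendsto_tsum_of_dominated_convergence (bound := fun m : Nat.factoredNumbers N.primeFactors =>
      ((m : ℕ) : ℝ)⁻¹ * C) (summable_factoredNumbers_inv.mul_right C) (fun m => ?_) ?_
    · have hm : ((m : ℕ) : ℂ) ≠ 0 := by exact_mod_cast m.2.1
      have hc : Tendsto (fun σ : ℝ => ((m : ℕ) : ℂ) ^ (-(σ : ℂ))) (𝓝[>] 1) (𝓝 (((m : ℕ) : ℂ) ^ (-(1 : ℂ)))) :=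
        ((continuous_neg.const_cpow (Or.inl hm)).tendsto (1 : ℂ)).comp tendsto_ofReal_nhdsGT_nhds
      exact hc.mul (hF1 _)
    · filter_upwards [hC, self_mem_nhdsWithin] with σ hσC hσ1
      intro m
      have hmpos : 0 < (m : ℕ) := Nat.pos_of_ne_zero m.2.1
      have hm1 : (1 : ℝ) ≤ (m : ℕ) := by exact_mod_cast hmpos
      rw [norm_mul, Complex.norm_natCast_cpow_of_pos hmpos, neg_re, Complex.ofReal_re]
      refine mul_le_mul ?_ (hσC _) (norm_nonneg _) (by positivity)
      rw [← Real.rpow_neg_one]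
      exact Real.rpow_le_rpow_of_exponent_le hm1 (by linarith [Set.mem_Ioi.mp hσ1])
  -- the smooth series `h = LSeries a`: derivative and continuity at `1`
  have hd := hasDerivAt_LSeries_indicator_factoredNumbers (N := N) (c := fun n : ℕ => S (n : ZMod N) / N) hSb
  have hcont : Tendsto (fun σ : ℝ => LSeries a σ) (𝓝[>] 1) (𝓝 (LSeries a 1)) :=
    hd.continuousAt.tendsto.comp tendsto_ofReal_nhdsGT_nhds
  -- (F8) `(σ−1)⁻¹ h(σ) → L(1,f) − B₁`
  have hF8 : Tendsto (fun σ : ℝ => ((σ : ℂ) - 1)⁻¹ * LSeries a σ) (𝓝[>] 1)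
      (𝓝 (ZMod.LFunction f 1 -
        ∑' m : Nat.factoredNumbers N.primeFactors, ((m : ℕ) : ℂ) ^ (-(1 : ℂ)) * ℓ (m : ℕ))) := by
    refine (hF6.sub hF7).congr' ?_
    filter_upwards [self_mem_nhdsWithin] with σ hσ
    rw [hdec σ (Set.mem_Ioi.mp hσ)]
    ring
  -- (F9) hence `h(1) = 0`
  have hzero : LSeries a 1 = 0 := by
    have h0 : Tendsto (fun σ : ℝ => ((σ : ℂ) - 1) * (((σ : ℂ) - 1)⁻¹ * LSeries a σ)) (𝓝[>] 1) (𝓝 0) := by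
      have h1 : Tendsto (fun σ : ℝ => (σ : ℂ) - 1) (𝓝[>] 1) (𝓝 0) := by
        simpa using tendsto_ofReal_nhdsGT_nhds.sub_const (1 : ℂ)
      simpa using h1.mul hF8
    have h0' : Tendsto (fun σ : ℝ => LSeries a σ) (𝓝[>] 1) (𝓝 0) := by
      refine h0.congr' ?_
      filter_upwards [self_mem_nhdsWithin] with σ hσ
      have hσ1 : (σ : ℂ) - 1 ≠ 0 := by
        rw [sub_ne_zero, Ne, Complex.ofReal_eq_one]
        exact ne_of_gt (Set.mem_Ioi.mp hσ)
      field_simp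
    exact tendsto_nhds_unique hcont h0'
  -- (F10) the slope of `h` at `1`
  have hF10 : Tendsto (fun σ : ℝ => ((σ : ℂ) - 1)⁻¹ * LSeries a σ) (𝓝[>] 1)
      (𝓝 (-∑' m : Nat.factoredNumbers N.primeFactors, ((m : ℕ) : ℂ) ^ (-(1 : ℂ)) *
        (Complex.log ((m : ℕ) : ℂ) * (S (m : ℕ) / N)))) := by
    refine (hd.tendsto_slope.comp tendsto_ofReal_nhdsGT).congr' ?_
    filter_upwards [self_mem_nhdsWithin] with σ hσ
    rw [Function.comp_apply, slope_def_field, hzero, sub_zero, div_eq_inv_mul]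
  -- (F11) uniqueness of limits
  have hval := tendsto_nhds_unique hF8 hF10
  refine ⟨?_, ?_⟩
  · rw [← LSeries_indicator_factoredNumbers_eq_tsum (N := N) (fun n : ℕ => S (n : ZMod N) / N) 1]
    exact hzero
  · rw [sub_eq_iff_eq_add'] at hval
    rw [hval]


omit [NeZero N] in
/-- `Σ_{m∈M(N)} c(m)/m` converges absolutely for bounded `c`. [cite: ChatterjeeMurty2014, §4 (proof of Theorem 3)] -/
theorem summable_factoredNumbers_div {c : ℕ → ℂ} {B : ℝ} (hc : ∀ n, ‖c n‖ ≤ B) :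
    Summable (fun m : Nat.factoredNumbers N.primeFactors => c m / ((m : ℕ) : ℂ)) := by
  have h := summable_factoredNumbers_cpow_mul (N := N) hc (s := 1) (by simp)
  simp_rw [cpow_neg_one, ← div_eq_inv_mul] at h
  exact h

/-- Re-indexing `ℤ/N` by the representatives `1, …, N`. [folklore] -/
private theorem sum_Icc_natCast_eq_sum_univ' {E : Type*} [AddCommMonoid E] (g : ZMod N → E) :
    ∑ a ∈ Icc 1 N, g (a : ZMod N) = ∑ j : ZMod N, g j := by
  have h1 : ∑ a ∈ Icc 1 N, g (a : ZMod N) = ∑ n ∈ range N, g ((n + 1 : ℕ) : ZMod N) := by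
    rw [Finset.range_eq_Ico, Finset.sum_Ico_add' (fun n : ℕ => g (n : ZMod N)) 0 N 1, zero_add,
      Finset.Ico_add_one_right_eq_Icc]
  rw [h1, Finset.sum_range (fun n => g ((n + 1 : ℕ) : ZMod N))]
  have hb : Function.Bijective (fun i : Fin N => (((i : ℕ) + 1 : ℕ) : ZMod N)) := by
    rw [Fintype.bijective_iff_injective_and_card]
    refine ⟨fun i j hij => ?_, by simp [ZMod.card]⟩
    have h1 : ((i : ℕ) + 1) ≡ ((j : ℕ) + 1) [MOD N] := (ZMod.natCast_eq_natCast_iff _ _ _).mp hij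
    have h3 : (i : ℕ) ≡ (j : ℕ) [MOD N] := Nat.ModEq.add_right_cancel' 1 h1
    exact Fin.ext (Nat.ModEq.eq_of_lt_of_lt h3 i.isLt j.isLt)
  exact Fintype.sum_bijective _ hb (fun i : Fin N => g (((i : ℕ) + 1 : ℕ) : ZMod N)) (fun a => g a)
    (fun _ => rfl)

/-- **No pole** («Note that the left hand side does not have a pole at `s = 1` and hence …
`Σ_{b∈M(q)} (f_b, χ₀)/b = 0`», display (6)): for `f : ℤ/N → ℂ` with `Σ_j f(j) = 0`,
`Σ_{m∈M(N)} (1/m) Σ_{j unit} f(mj) = 0`. [cite: ChatterjeeMurty2014, §4 (proof of Theorem 3, display (6))] -/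
theorem tsum_sum_units_div_eq_zero (f : ZMod N → ℂ) (hf : ∑ j : ZMod N, f j = 0) :
    ∑' m : Nat.factoredNumbers N.primeFactors,
      (∑ j : ZMod N, (1 : DirichletCharacter ℂ N) j * f ((m : ℕ) * j)) / ((m : ℕ) : ℂ) = 0 := by
  have hN : (N : ℂ) ≠ 0 := by exact_mod_cast NeZero.ne N
  have h := (LFunction_one_eq_tsum_aux f hf).1
  have h2 : ∑' m : Nat.factoredNumbers N.primeFactors,
      (∑ j : ZMod N, (1 : DirichletCharacter ℂ N) j * f ((m : ℕ) * j)) / ((m : ℕ) : ℂ) =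
      (N : ℂ) * ∑' m : Nat.factoredNumbers N.primeFactors, ((m : ℕ) : ℂ) ^ (-(1 : ℂ)) *
        ((∑ j : ZMod N, (1 : DirichletCharacter ℂ N) j * f ((m : ℕ) * j)) / N) := by
    rw [← tsum_mul_left]
    refine tsum_congr fun m => ?_
    rw [cpow_neg_one]
    field_simp
  rw [h2, h, mul_zero]

/-- **`L(1,f)` through the `M(N)`-decomposition** (the limit `s → 1⁺` of display (5) summed over the unit
classes, with Mathlib's `L(1,f) = ZMod.LFunction f 1`): for `f : ℤ/N → ℂ` with `Σ_j f(j) = 0`,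
`N·L(1,f) = −Σ_{m∈M(N)} (1/m) Σ_{a=1}^{N} χ₀(a) f(ma)(ψ(a/N) + log N) − Σ_{m∈M(N)} (log m/m) Σ_{j unit} f(mj)`
(`ψ` = digamma; the first sum is `Σ_m (1/m)·[N × constant term of L(s, χ₀f(m·)) at s = 1]`, the second the
derivative of the pole-carrying part). [cite: ChatterjeeMurty2014, §4 (proof of Theorem 3, displays (5)–(8))] -/
theorem LFunction_one_eq_tsum (f : ZMod N → ℂ) (hf : ∑ j : ZMod N, f j = 0) :
    (N : ℂ) * ZMod.LFunction f 1 =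
      -(∑' m : Nat.factoredNumbers N.primeFactors,
          (∑ a ∈ Icc 1 N, (1 : DirichletCharacter ℂ N) (a : ZMod N) * f ((m : ℕ) * (a : ZMod N)) *
            (Complex.digamma ((a : ℂ) / N) + Real.log N)) / ((m : ℕ) : ℂ)) -
      ∑' m : Nat.factoredNumbers N.primeFactors,
        Complex.log ((m : ℕ) : ℂ) * (∑ j : ZMod N, (1 : DirichletCharacter ℂ N) j * f ((m : ℕ) * j)) /
          ((m : ℕ) : ℂ) := by
  have hN : (N : ℂ) ≠ 0 := by exact_mod_cast NeZero.ne N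
  have h := (LFunction_one_eq_tsum_aux f hf).2
  have e1 : (N : ℂ) * ∑' m : Nat.factoredNumbers N.primeFactors, ((m : ℕ) : ℂ) ^ (-(1 : ℂ)) *
        (-(N : ℂ)⁻¹ * ∑ a ∈ Icc 1 N, (1 : DirichletCharacter ℂ N) (a : ZMod N) * f ((m : ℕ) * (a : ZMod N)) *
          (Complex.digamma ((a : ℂ) / N) + Real.log N)) =
      -(∑' m : Nat.factoredNumbers N.primeFactors,
          (∑ a ∈ Icc 1 N, (1 : DirichletCharacter ℂ N) (a : ZMod N) * f ((m : ℕ) * (a : ZMod N)) *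
            (Complex.digamma ((a : ℂ) / N) + Real.log N)) / ((m : ℕ) : ℂ)) := by
    rw [← tsum_mul_left, ← tsum_neg]
    refine tsum_congr fun m => ?_
    have hm : ((m : ℕ) : ℂ) ≠ 0 := by exact_mod_cast m.2.1
    rw [cpow_neg_one]
    field_simp
  have e2 : (N : ℂ) * ∑' m : Nat.factoredNumbers N.primeFactors, ((m : ℕ) : ℂ) ^ (-(1 : ℂ)) *
        (Complex.log ((m : ℕ) : ℂ) * ((∑ j : ZMod N, (1 : DirichletCharacter ℂ N) j * f ((m : ℕ) * j)) / N)) =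
      ∑' m : Nat.factoredNumbers N.primeFactors,
        Complex.log ((m : ℕ) : ℂ) * (∑ j : ZMod N, (1 : DirichletCharacter ℂ N) j * f ((m : ℕ) * j)) /
          ((m : ℕ) : ℂ) := by
    rw [← tsum_mul_left]
    refine tsum_congr fun m => ?_
    have hm : ((m : ℕ) : ℂ) ≠ 0 := by exact_mod_cast m.2.1
    rw [cpow_neg_one]
    field_simp
  rw [h, mul_add, mul_neg, e1, e2]
  ring

/-- **`L(1,f)` in the form used by Okada's criterion**: for `f : ℤ/N → ℂ` with `Σ_j f(j) = 0`,
`N·L(1,f) = −Σ_{a=1}^{N} χ₀(a) ψ(a/N)·[Σ_{m∈M(N)} f(ma)/m] − Σ_{m∈M(N)} (log m/m)·Σ_{j unit} f(mj)` — the first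
bracket is the function `G(a) = Σ_{m∈M(q)} f(am)/m` of Okada's first condition, the last sum is
`φ(q)·Σ_{b∈M(q)} (f_b,χ₀) log b/b` of Chatterjee–Murty's Theorem 3 (the `log N` term drops by
`tsum_sum_units_div_eq_zero`). [cite: ChatterjeeMurty2014, Theorem 3 and §4 (displays (6)–(8))] -/
theorem LFunction_one_eq_sum_digamma_mul_tsum (f : ZMod N → ℂ) (hf : ∑ j : ZMod N, f j = 0) :
    (N : ℂ) * ZMod.LFunction f 1 =
      -(∑ a ∈ Icc 1 N, (1 : DirichletCharacter ℂ N) (a : ZMod N) * Complex.digamma ((a : ℂ) / N) *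
          ∑' m : Nat.factoredNumbers N.primeFactors, f ((m : ℕ) * (a : ZMod N)) / ((m : ℕ) : ℂ)) -
      ∑' m : Nat.factoredNumbers N.primeFactors,
        Complex.log ((m : ℕ) : ℂ) * (∑ j : ZMod N, (1 : DirichletCharacter ℂ N) j * f ((m : ℕ) * j)) /
          ((m : ℕ) : ℂ) := by
  rw [LFunction_one_eq_tsum f hf]
  congr 2
  -- split off the `log N` part, which vanishes by `tsum_sum_units_div_eq_zero`
  have hsplit : ∀ m : Nat.factoredNumbers N.primeFactors,
      (∑ a ∈ Icc 1 N, (1 : DirichletCharacter ℂ N) (a : ZMod N) * f ((m : ℕ) * (a : ZMod N)) *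
          (Complex.digamma ((a : ℂ) / N) + Real.log N)) / ((m : ℕ) : ℂ) =
        (∑ a ∈ Icc 1 N, (1 : DirichletCharacter ℂ N) (a : ZMod N) * Complex.digamma ((a : ℂ) / N) *
          (f ((m : ℕ) * (a : ZMod N)) / ((m : ℕ) : ℂ))) +
        (Real.log N : ℂ) * ((∑ j : ZMod N, (1 : DirichletCharacter ℂ N) j * f ((m : ℕ) * j)) /
          ((m : ℕ) : ℂ)) := by
    intro m
    rw [← sum_Icc_natCast_eq_sum_univ' (fun j => (1 : DirichletCharacter ℂ N) j * f ((m : ℕ) * j)),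
      Finset.sum_div, Finset.sum_div, Finset.mul_sum, ← Finset.sum_add_distrib]
    exact Finset.sum_congr rfl fun a _ => by ring
  have hsum1 : ∀ a ∈ Icc 1 N, Summable fun m : Nat.factoredNumbers N.primeFactors =>
      (1 : DirichletCharacter ℂ N) (a : ZMod N) * Complex.digamma ((a : ℂ) / N) *
        (f ((m : ℕ) * (a : ZMod N)) / ((m : ℕ) : ℂ)) := by
    intro a _
    simp_rw [← mul_div_assoc]
    exact summable_factoredNumbers_div
      (c := fun n : ℕ => (1 : DirichletCharacter ℂ N) (a : ZMod N) * Complex.digamma ((a : ℂ) / N) *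
        f ((n : ZMod N) * (a : ZMod N)))
      (fun n => norm_le_sum_norm (fun c : ZMod N => (1 : DirichletCharacter ℂ N) (a : ZMod N) *
        Complex.digamma ((a : ℂ) / N) * f (c * (a : ZMod N))) n)
  have hsum2 : Summable fun m : Nat.factoredNumbers N.primeFactors =>
      (Real.log N : ℂ) * ((∑ j : ZMod N, (1 : DirichletCharacter ℂ N) j * f ((m : ℕ) * j)) /
        ((m : ℕ) : ℂ)) :=
    (summable_factoredNumbers_div (c := fun n : ℕ => ∑ j : ZMod N, (1 : DirichletCharacter ℂ N) j *
      f ((n : ZMod N) * j)) (fun n => norm_le_sum_norm (fun c : ZMod N => ∑ j : ZMod N,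
        (1 : DirichletCharacter ℂ N) j * f (c * j)) n)).mul_left _
  rw [tsum_congr hsplit, (summable_sum hsum1).tsum_add hsum2, tsum_mul_left, tsum_sum_units_div_eq_zero f hf,
    mul_zero, add_zero, Summable.tsum_finsetSum hsum1]
  refine Finset.sum_congr rfl fun a _ => ?_
  rw [tsum_mul_left]

end ChatterjeeMurty2014

end Literature.NumberTheory.LFunctions

end
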